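import Mathlib
import Literature.MathematicalPhysics.QuantumManyBody.BoseEinsteinCondensation
import Literature.MathematicalPhysics.QuantumManyBody.NeumannBoxParseval
import Summits.AtomisticToContinuum.BoseEinsteinCondensation.Theorems.SoloBlindInfraredBEC

/-!
# The infrared criterion for BEC in physical units

Solo seat `solo-AtomisticToContinuum-blind`, conjunct `BoseEinsteinCondensation`.

`hasGroundStateBEC_of_infrared_bound` (file `SoloBlindInfraredBEC`) is stated with a mode cutoff `M`
and abstract constants `A, T`.  Here we record the form in which it is used: with `L = (N/ρ)^{1/3}`,
`κ = π k / L` the physical wave vector of the Neumann mode `u_k`, an **infrared bound**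
`N_k(Ψ) ≤ C / |κ| = C L / (π |k|)` for all modes with `0 < ‖κ‖_∞ ≤ K`, together with a kinetic bound
`∫ |∇Ψ|² ≤ e · N` along the near-minimisers, gives Bose–Einstein condensation with condensate
fraction `≥ 1 - 7 C K² / (π³ ρ) - e / K²` — so BEC holds as soon as `7 C K²/(π³ ρ) + e/K² < 1`
(`hasGroundStateBEC_of_infrared_bound_physical`).  The proof is the choice `M = ⌊K L / π⌋`,
`A = C L / π`, `T = e N` and the identity `L³ = N / ρ`.
-/

noncomputable section

open MeasureTheory Filter Set
open scoped ENNReal NNReal Real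

namespace Summit.AtomisticToContinuum.BoseEinsteinCondensation.Theorems

open Literature.MathematicalPhysics.QuantumManyBody.BoseGas
open Literature.MathematicalPhysics.QuantumManyBody.NeumannBox

/-- `L³ = N/ρ` for `L = sideLength ρ N`, `ρ > 0` (local copy). -/
private theorem soloSideLength_cube {ρ : ℝ} (hρ : 0 < ρ) (N : ℕ) :
    sideLength ρ N ^ 3 = (N : ℝ) / ρ := by
  have h : (0 : ℝ) ≤ N / ρ := div_nonneg N.cast_nonneg hρ.le
  rw [sideLength, ← Real.rpow_natCast, ← Real.rpow_mul h]
  norm_num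

/-- The arithmetic of the cutoff choice: with `M = ⌊K L/π⌋`, `L³ = N/ρ`,
`7 (C L/π) M² + e N (L/(π (M+1)))² ≤ (7 C K²/(π³ ρ) + e/K²) N`. -/
theorem infrared_cutoff_arith {ρ C e K L : ℝ} (hρ : 0 < ρ) (hC : 0 ≤ C) (he : 0 ≤ e) (hK : 0 < K)
    (hL : 0 < L) {N : ℝ} (hN : 0 ≤ N) (hL3 : L ^ 3 = N / ρ) :
    7 * (C * L / π) * (⌊K * L / π⌋₊ : ℝ) ^ 2 + e * N * (L / (π * (⌊K * L / π⌋₊ + 1))) ^ 2 ≤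
      (7 * C * K ^ 2 / (π ^ 3 * ρ) + e / K ^ 2) * N := by
  have hπ : 0 < π := Real.pi_pos
  have hx : 0 ≤ K * L / π := div_nonneg (mul_nonneg hK.le hL.le) hπ.le
  have hM : (⌊K * L / π⌋₊ : ℝ) ≤ K * L / π := Nat.floor_le hx
  have hM1 : K * L / π < (⌊K * L / π⌋₊ : ℝ) + 1 := Nat.lt_floor_add_one _
  have hM0 : (0 : ℝ) ≤ ⌊K * L / π⌋₊ := Nat.cast_nonneg _
  -- first term
  have h1 : 7 * (C * L / π) * (⌊K * L / π⌋₊ : ℝ) ^ 2 ≤ 7 * C * K ^ 2 / (π ^ 3 * ρ) * N := by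
    have hsq : (⌊K * L / π⌋₊ : ℝ) ^ 2 ≤ (K * L / π) ^ 2 := pow_le_pow_left₀ hM0 hM 2
    calc 7 * (C * L / π) * (⌊K * L / π⌋₊ : ℝ) ^ 2
        ≤ 7 * (C * L / π) * (K * L / π) ^ 2 := by
          gcongr
      _ = 7 * C * K ^ 2 / (π ^ 3 * ρ) * (ρ * L ^ 3) := by
          field_simp
      _ = 7 * C * K ^ 2 / (π ^ 3 * ρ) * N := by
          rw [hL3]; field_simp
  -- second term
  have h2 : e * N * (L / (π * (⌊K * L / π⌋₊ + 1))) ^ 2 ≤ e / K ^ 2 * N := by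
    have hden : 0 < π * ((⌊K * L / π⌋₊ : ℝ) + 1) := mul_pos hπ (by linarith)
    have hfrac : L / (π * ((⌊K * L / π⌋₊ : ℝ) + 1)) ≤ 1 / K := by
      rw [div_le_div_iff₀ hden hK, one_mul]
      have : K * L < π * ((⌊K * L / π⌋₊ : ℝ) + 1) := by
        rw [div_lt_iff₀ hπ] at hM1
        linarith
      linarith
    have hfrac0 : 0 ≤ L / (π * ((⌊K * L / π⌋₊ : ℝ) + 1)) := div_nonneg hL.le hden.le
    calc e * N * (L / (π * (⌊K * L / π⌋₊ + 1))) ^ 2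
        ≤ e * N * (1 / K) ^ 2 := by
          gcongr
      _ = e / K ^ 2 * N := by
          field_simp
  calc _ ≤ 7 * C * K ^ 2 / (π ^ 3 * ρ) * N + e / K ^ 2 * N := add_le_add h1 h2
    _ = _ := by ring

/-- **Infrared criterion for BEC, physical form.** Let `ρ > 0`, `C, e ≥ 0`, `K > 0` with
`7 C K²/(π³ ρ) + e/K² < 1`. Suppose that for all large `N = n+1`, with `L = (N/ρ)^{1/3}`, there is
`δ > 0` such that every trial state within `δ` of the ground-state energy has kinetic energy
`≤ e N` and satisfies the infrared bound `N_k(Ψ) ≤ (C L/π)/|k|` (that is, `≤ C/|κ|` at the physical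
wave vector `κ = π k/L`) for every Neumann mode `k ≠ 0` with `k_i ≤ K L/π` for all `i`. Then the
ground state exhibits Bose–Einstein condensation at density `ρ`: `HasGroundStateBEC v ρ`
(with condensate fraction `≥ 1 - 7 C K²/(π³ ρ) - e/K²`). -/
theorem hasGroundStateBEC_of_infrared_bound_physical (v : ℝ → ℝ≥0∞) {ρ : ℝ} (hρ : 0 < ρ)
    {C e K : ℝ} (hC : 0 ≤ C) (he : 0 ≤ e) (hK : 0 < K)
    (hsmall : 7 * C * K ^ 2 / (π ^ 3 * ρ) + e / K ^ 2 < 1)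
    (h : ∀ᶠ n : ℕ in atTop, ∃ δ : ℝ≥0∞, 0 < δ ∧
      ∀ Ψ : TrialState (n + 1) (sideLength ρ (n + 1)),
        energy v Ψ ≤ groundStateEnergy v (n + 1) (sideLength ρ (n + 1)) + δ →
        ∫⁻ X, kineticDensity Ψ.ψ X ≤ ENNReal.ofReal e * (n + 1) ∧
        ∀ k : Fin 3 → ℕ, k ≠ 0 → (∀ i, (k i : ℝ) ≤ K * sideLength ρ (n + 1) / π) →
          (n + 1 : ℝ≥0∞) * ∫⁻ Y : Config n, ‖∫ x in box (sideLength ρ (n + 1)),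
              (mode (sideLength ρ (n + 1)) k x : ℂ) * Ψ.ψ (Matrix.vecCons x Y)‖ₑ ^ 2 ≤
            ENNReal.ofReal (C * sideLength ρ (n + 1) / π) /
              ENNReal.ofReal (Real.sqrt (∑ i, (k i : ℝ) ^ 2))) :
    HasGroundStateBEC v ρ := by
  have hη0 : 0 ≤ 7 * C * K ^ 2 / (π ^ 3 * ρ) + e / K ^ 2 := by positivity
  refine hasGroundStateBEC_of_infrared_bound v hρ
    (η := ENNReal.ofReal (7 * C * K ^ 2 / (π ^ 3 * ρ) + e / K ^ 2))
    (ENNReal.ofReal_lt_one.2 hsmall) ?_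
  filter_upwards [h] with n hn
  obtain ⟨δ, hδ, hΨ⟩ := hn
  have hπ : 0 < π := Real.pi_pos
  have hNpos : (0 : ℝ) < ((n + 1 : ℕ) : ℝ) := by exact_mod_cast Nat.succ_pos n
  have hL : 0 < sideLength ρ (n + 1) := by
    rw [sideLength]
    exact Real.rpow_pos_of_pos (div_pos hNpos hρ) _
  have hL3 : sideLength ρ (n + 1) ^ 3 = ((n + 1 : ℕ) : ℝ) / ρ := soloSideLength_cube hρ (n + 1)
  refine ⟨δ, hδ, ⌊K * sideLength ρ (n + 1) / π⌋₊,
    ENNReal.ofReal (C * sideLength ρ (n + 1) / π), ENNReal.ofReal e * (n + 1), ?_, fun Ψ hE => ?_⟩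
  · -- the arithmetic condition, transported to `ℝ`
    have hA0 : 0 ≤ C * sideLength ρ (n + 1) / π := div_nonneg (mul_nonneg hC hL.le) hπ.le
    have hsq0 : 0 ≤ (sideLength ρ (n + 1) / (π * (⌊K * sideLength ρ (n + 1) / π⌋₊ + 1))) ^ 2 :=
      sq_nonneg _
    have key := infrared_cutoff_arith hρ hC he hK hL hNpos.le hL3
    have lhs_eq : 7 * ENNReal.ofReal (C * sideLength ρ (n + 1) / π) *
          (⌊K * sideLength ρ (n + 1) / π⌋₊ : ℝ≥0∞) ^ 2 +
        ENNReal.ofReal e * (n + 1) *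
          ENNReal.ofReal ((sideLength ρ (n + 1) / (π * (⌊K * sideLength ρ (n + 1) / π⌋₊ + 1))) ^ 2) =
        ENNReal.ofReal (7 * (C * sideLength ρ (n + 1) / π) * (⌊K * sideLength ρ (n + 1) / π⌋₊ : ℝ) ^ 2 +
          e * ((n + 1 : ℕ) : ℝ) *
            (sideLength ρ (n + 1) / (π * (⌊K * sideLength ρ (n + 1) / π⌋₊ + 1))) ^ 2) := by
      rw [ENNReal.ofReal_add (by positivity) (by positivity),
        ENNReal.ofReal_mul (by positivity), ENNReal.ofReal_mul (by positivity),
        ENNReal.ofReal_mul (by positivity), ENNReal.ofReal_mul he,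
        ENNReal.ofReal_pow (Nat.cast_nonneg _), ENNReal.ofReal_natCast, ENNReal.ofReal_natCast]
      norm_num
    have rhs_eq : ENNReal.ofReal (7 * C * K ^ 2 / (π ^ 3 * ρ) + e / K ^ 2) * (n + 1 : ℝ≥0∞) =
        ENNReal.ofReal ((7 * C * K ^ 2 / (π ^ 3 * ρ) + e / K ^ 2) * ((n + 1 : ℕ) : ℝ)) := by
      rw [ENNReal.ofReal_mul hη0, ENNReal.ofReal_natCast]
      norm_num
    rw [lhs_eq, rhs_eq]
    exact ENNReal.ofReal_le_ofReal key
  · obtain ⟨hT, hIR⟩ := hΨ Ψ hE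
    refine ⟨hT, fun k hk hkM => hIR k hk fun i => ?_⟩
    exact (Nat.cast_le.2 (hkM i)).trans (Nat.floor_le (div_nonneg (mul_nonneg hK.le hL.le) hπ.le))

end Summit.AtomisticToContinuum.BoseEinsteinCondensation.Theorems

end
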